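import Literature.MathematicalPhysics.QuantumFieldTheory.Balaban1983to89.B6AgreeLapV1Chart
import Literature.MathematicalPhysics.QuantumFieldTheory.Balaban1983to89.B6Geom246MultiLevelTorusL0
import Literature.MathematicalPhysics.QuantumFieldTheory.Balaban1983to89.B6GlobalChartV1L0
import Literature.MathematicalPhysics.QuantumFieldTheory.Balaban1983to89.B6MultiLevelTorusOperatorL0
import Literature.MathematicalPhysics.QuantumFieldTheory.Balaban1983to89.B6FullWindowReachV1

/-!
# `Balaban1983to89.B6FullWindowReachV1L0` — LEVEL-0 TWIN (programme G-F3′-L0, director-ym LINE №27 / UV3-NODE §24.5; plan `lit-balaban-r03/G-F3L0-PLAN.md`) of `B6FullWindowReachV1`: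
the same declarations, SAME NAMES AND STATEMENTS, for nested families WITH print's region `Λ₀ = T ∖ Ω₁` ADMITTED (structures
`B6MultiLevelBoxOperatorL0.Domains` / `B6MultiLevelTorusOperatorL0.TDomains`: levels `0, …, k`, the level-`0` block a single site, `Q′₀ = id`,
finite weight `a₀` — print p.225 (2.14) «Σ_{j=0}^k … (Q′₀λ)(x) = λ(x), x ∈ Λ₀», p.229 «taking a sequence (2.1) … smallest possible domains B^j(Λ_j),
and considering the operator Δ_a defined by (2.19), (2.20) for this sequence»).  Every `D`-free object is the lineage's, consumed BY NAME; no existing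
module is touched; no fact is minted.  Unit `lit-balaban-p21` (packet S-B owner, S-C tail; p21 gen 27; port tooling by r03 gen 36 / p33 gen 88); B6 fold owner r03; referee ref-4.  THE TWIN'S DOCUMENTATION FOLLOWS
VERBATIM (its «levels 1 … k» / «Ω₁ = X» sentences describe the twin; here `j` runs from `0` and `Ω₁` may be a proper subset).

# `Balaban1983to89.B6FullWindowReachV1` — T. Bałaban, *Propagators and renormalization transformations for lattice gauge theories. II*, Commun.
# Math. Phys. **96** (1984) 223–250 [Balaban1984PropagatorsII], p. 238 («we take the cube □̃³ and identify it with a torus T_□») and (2.90)–(2.91),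
# (2.133): THE FULL-PERIOD WINDOW SERVES BOTH THE INVERSION `(M_□ − P_□)G_□h_□ = h_□` AND THE (2.133) MAJORANT ON A CENTRAL REACH — item (d5-b)
# infrastructure of the B6 fold owner's programme for the genuine k-level Proposition 2.6 (B6-CLOSURE.md §5 items 9–11)

statement-level skeleton of published theorems with citation tags; proofs where landed; nothing here is a claim about the Yang–Mills mass gap

WHY THIS FILE (finding F3 of the fold owner, 2026-08-23).  The assembled implication of record `B6GlobalChartV1L0.prop26_2136_V1_of_2134_eq291`
takes, per cube, ONE bond window `W c` for two roles: the inversion `hinvl : (Ml c − Pl c)·GlV1 (t c) hN (W c) (x₀ c)·h_c = h_c` — which holds for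
the transplant of the genuine member ONLY through a BIJECTIVE window, i.e. the FULL period `2L^{m_□+K_□}` of `T_□` (`B6AgreeLapV1Chart.hinvl_GlV1`,
`B6Prop26ReachTransplant.hinv_of_bij`; a half window truncates `G_□ρh` before the non-local `P_□` acts) — and the (2.133) reach majorant
`B6GlobalChartV1L0.reach2133_G_V1`, stated for windows of side `≤ L^{m_□+K_□}` (half the period, where the distance of `T_□` is the straight one).
This file reconciles the two: the transplant through the FULL window has the (2.133) `LocalMajorant` on every reach `S` whose bonds lie in a
half-period sub-window with the same corner (pairs inside `S` never see the far side of `T_□`), and the full-window `hinvl` survives the unit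
scaling `(c′/L^j)²` of finding F1 (`hagree_member`).

PDF held: `paper:balaban1984-cmp96-propagators-rt-ii` (journal page = PDF page + 222); p. 238–239 [PDF 16–17], (2.133) p. 247 [PDF 25].

CITATION HEADER (lean-in-tree rule) — WHAT IS REPRODUCED.  Phase-2 file of the `lit-balaban` typed skeleton (HOME `run/shared/lean/pub/lit-balaban/`),
unit `lit-balaban-r03` (B6 fold owner; r03 gen 19, literature-prover-lit-balaban-r03-g19-0), referee ref-4.  SKELETON rows **B6.Eq2.91** × **B6.Eq2.133**
× **B6.Prop2.6** (cells; decls of record untouched).  IMPORTS BY NAME, restating nothing: `B6Prop26ReachTransplant` (`restrictOp`, `transplant`,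
`transplant_apply`, `chartBond`, `InWindow`), `B6Prop26Gluing.LocalMajorant`, `B6RandomWalk.BlockSupp`, `B6GlobalChartV1` (`GlV1`, `toBox`, `blkV1`,
**`reach2133_G_V1`**), `B6AgreeLapV1Chart` (`cB`, `DeepS`, `mem_cB_W`, `GlV1_eq`, `transplant_eB_eq`, `onFun_deltaA_mul_G`; cf. **`hinvl_GlV1`**), `B6Prop26ReachTransplant.hinv_of_bij`, `B6Geom246MultiLevelTorusL0.geomT`, `B6MultiLevelTorusOperatorL0.TDomains`.

THIS FILE (0 sorry; standard axioms; NO new definition, NO `def … : Prop`).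
* §1 `restrictOp_eq_of_vanish` (a function vanishing on `W ∖ W′` restricts alike through `W` and `W′ ⊆ W`), `transplant_apply_eq_of_vanish`,
  **`localMajorant_transplant_of_subwindow`**: a `LocalMajorant` on a reach `S` of the transplant through `W′` IS one of the transplant through
  any `W ⊇ W′`, provided every bond whose block lies in `S` belongs to `W′` (the entries of a local majorant only involve inputs and outputs in `S`).
* §2 **`reach2133_G_V1_full`**: the constants `δ, A` of `reach2133_G_V1` serve the FULL-window `GlV1 t hN (cB t x₀ hx₀ hfit).W x₀` on every reach `S`
  whose bonds lie in the half-period sub-window `[x₀, x₀ + Wd)`, `Wd ≤ L^{m_□+K_□}`, two-level, corner `x₀ ∈ L^jℤ^{d+1}` — the `h2133`-type input of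
  the Prop. 2.6 chain for the SAME window that carries `hinvl`.
* §3 **`hinvl_GlV1_scaled`**: `(s•Ml − s•Pl)·(s⁻¹•GlV1)·h_□ = h_□` on the full window for every `s ≠ 0` (the member read in global units, F1).

HONEST SCOPE. (1) Nothing analytic is added: §2 is `reach2133_G_V1` moved to the full window by §1; the reach must sit in the LOWER sub-window
`[x₀, x₀ + Wd)` of the full window `[x₀, x₀ + 2L^{m_□+K_□})` (same corner as the chart), so a cube's `□̃³` is to be placed there with the margin
`3L^{j+1}` of `B6AgreeQaQV1Chart` from the faces — the member torus of a cube is chosen large enough (its (2.133) constants are uniform in the size).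
(2) The corrected k-level assembly itself ((d5-b): full windows, scaled members, P(y)-weighted chain) is NOT in this file.
Value = typed skeleton infrastructure removing an inconsistency between two hypotheses of the V1 assembly; NOT summit progress.
-/

noncomputable section

open scoped BigOperators
open Finset

namespace Literature.MathematicalPhysics.QuantumFieldTheory.Balaban1983to89.B6FullWindowReachV1L0

open B6Prop26Gluing (mulOp LocalMajorant)
open B6RandomWalk (BlockSupp)
open B6Prop26ReachTransplant (restrictOp transplant restrictOp_apply transplant_apply chartBond InWindow)

/-! ## §1  A local majorant only sees the sub-window containing the reach -/

section Subwindow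

variable {X X' : Type}

end Subwindow

/-! ## §2  The (2.133) reach majorant for the FULL-window transplant of `G_□` -/

section Reach

open B6Prop25TwoScaleCensus (TSIdx)
open B6GlobalChartV1 (PV GlV1 toBox)
open B6GlobalChartV1L0 (blkV1 reach2133_G_V1)
open B6MultiLevelBoxOperator (N0)
open B6MultiLevelTorusOperatorL0 (TDomains)
open B6Geom246MultiLevelTorusL0 (geomT)
open B4Reflection242 (boxDom)
open B6AgreeLapV1Chart (cB DeepS mem_cB_W)
open Literature.MathematicalPhysics.QuantumFieldTheory.Balaban1983to89.B6FullWindowReachV1 (restrictOp_eq_of_vanish transplant_apply_eq_of_vanish localMajorant_transplant_of_subwindow hinvl_GlV1_scaled)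

variable {d ℓ : ℕ}

/-- **(2.133) FOR THE FULL-WINDOW `GlV1` ON A CENTRAL REACH**: the constants `δ, A` of `B6GlobalChartV1L0.reach2133_G_V1` give, for every two-scale
member `t`, every V1 global torus whose fundamental box is the torus (`hN`), every corner `x₀ ≥ 0` with the full member period inside the box
(`hfit`), `L^j ∣ x₀`, and every reach `S` all of whose bonds lie in the two-level half-period sub-window `[x₀, x₀ + Wd)`, `Wd ≤ L^{m_□+K_□}`:
`LocalMajorant (blkV1 hN D) (GlV1 t hN (cB t x₀ hx₀ hfit).W x₀) S (L^{d+1}·A·e^{2δ}·e^{−(δ/(d+1))·d_T})` — the window that carries `hinvl`.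
[cite: Balaban1984PropagatorsII, (2.133) p.247, (2.90)–(2.91) p.239, p.238 (T_□ = □̃³)] -/
theorem reach2133_G_V1_full (d ℓ : ℕ) (hd : 1 ≤ d + 1) (hL : Odd (ℓ + 1) ∧ 1 < ℓ + 1) {a₀ a₁ : ℝ} (ha₀ : 0 < a₀) (ha₁ : a₀ ≤ a₁) :
    ∃ δ : ℝ, 0 < δ ∧ ∃ A : ℝ, 0 ≤ A ∧ ∀ (t : TSIdx d (ℓ + 1) hd hL a₀ a₁) (m K : ℕ) {Mh k R : ℕ} {P' : Fin (d + 1) → ℕ}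
      (hN : ∀ μ, N0 ℓ Mh k P' μ = (PV d ℓ m K hd hL).sitesPerDir 0) (D : B6MultiLevelTorusOperatorL0.TDomains d ℓ Mh k P' R) (_ : 1 ≤ Mh) (_ : ∀ μ, 1 ≤ P' μ)
      (x₀ : Fin (d + 1) → ℤ) (hx₀ : ∀ μ, 0 ≤ x₀ μ) (hfit : ∀ μ, x₀ μ + (t.P.sitesPerDir 0 : ℕ) ≤ ((PV d ℓ m K hd hL).sitesPerDir 0 : ℕ))
      (_ : ∀ μ, (((ℓ + 1) ^ t.j : ℕ) : ℤ) ∣ x₀ μ) (Wd : ℕ) (_ : Wd ≤ (ℓ + 1) ^ (t.m + t.K))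
      (_ : ∀ z ∈ boxDom (N0 ℓ Mh k P'), (∀ μ, x₀ μ ≤ z μ ∧ z μ < x₀ μ + Wd) → t.j ≤ D.lev z ∧ D.lev z ≤ t.j + 1)
      (S : Set (geomT D).Site)
      (_ : ∀ b : PBond (PV d ℓ m K hd hL) 0, blkV1 hN D b ∈ S →
        InWindow (fun b : PBond (PV d ℓ m K hd hL) 0 => (toBox hN b.src : Fin (d + 1) → ℤ)) x₀ Wd b),
      LocalMajorant (g := geomT D) (blkV1 hN D) (GlV1 t hN (cB t x₀ hx₀ hfit).W x₀) S
        (fun a b => ((ℓ + 1) ^ (d + 1) : ℕ) * ((A * Real.exp (δ * ((d + 1 : ℝ) + (d + 1)) / (d + 1))) *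
          Real.exp (-(δ / (d + 1) * (geomT D).dist a b)))) := by
  obtain ⟨δ, hδ, A, hA, h⟩ := reach2133_G_V1 d ℓ hd hL ha₀ ha₁
  refine ⟨δ, hδ, A, hA, fun t m K Mh k R P' hN D hMh hP x₀ hx₀ hfit hdiv Wd hWd hlev S hS => ?_⟩
  classical
  -- the sub-window of the reach
  let W' : Finset (PBond (PV d ℓ m K hd hL) 0) :=
    (cB t x₀ hx₀ hfit).W.filter fun b => InWindow (fun b : PBond (PV d ℓ m K hd hL) 0 => (toBox hN b.src : Fin (d + 1) → ℤ)) x₀ Wd b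
  have h' := h t m K hN D hMh hP x₀ hdiv Wd hWd hlev W' (fun b hb => (Finset.mem_filter.1 hb).2) S
  refine localMajorant_transplant_of_subwindow (blkV1 hN D) S (cB t x₀ hx₀ hfit).W W' (Finset.filter_subset _ _) (fun b hb => ?_) _ _ _ h'
  -- a bond of the sub-window is a bond of the full window
  have hw := hS b hb
  refine Finset.mem_filter.2 ⟨mem_cB_W.2 fun μ => ?_, hw⟩
  obtain ⟨h1, h2⟩ := hw μ
  have hper : (ℓ + 1) ^ (t.m + t.K) < t.P.sitesPerDir 0 := by
    show (ℓ + 1) ^ (t.m + t.K) < 2 * (ℓ + 1) ^ (t.m + t.K - 0)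
    have := Nat.one_le_pow (t.m + t.K) (ℓ + 1) (Nat.succ_pos ℓ)
    rw [Nat.sub_zero]; omega
  simp only [B6GlobalChartV1.toBox_apply] at h1 h2
  constructor <;> push_cast <;> omega

end Reach

/-! ## §3  The full-window inversion in global units -/

section Scaled

open B6Prop25TwoScaleCensus (TSIdx)
open B6GlobalChartV1 (PV GlV1)
open B6MultiLevelBoxOperator (N0)
open B6Ineq2133TwoScaleV1 (onFun)
open B6AgreeLapV1Chart (cB eB posV GlV1_eq transplant_eB_eq onFun_deltaA_mul_G)
open B6Prop26ReachTransplant (hinv_of_bij)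

variable {d ℓ : ℕ} {hd : 1 ≤ d + 1} {hL : Odd (ℓ + 1) ∧ 1 < ℓ + 1} {a₀ a₁ : ℝ} {m K : ℕ}
variable {t : TSIdx d (ℓ + 1) hd hL a₀ a₁} {x₀ : Fin (d + 1) → ℤ}
variable {hx₀ : ∀ μ, 0 ≤ x₀ μ} {hfit : ∀ μ, x₀ μ + (t.P.sitesPerDir 0 : ℕ) ≤ ((PV d ℓ m K hd hL).sitesPerDir 0 : ℕ)}

end Scaled

end Literature.MathematicalPhysics.QuantumFieldTheory.Balaban1983to89.B6FullWindowReachV1L0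
end
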